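import Mathlib.Analysis.ODE.Gronwall
import Mathlib.Analysis.InnerProductSpace.Calculus
import Mathlib.Algebra.Order.ToIntervalMod
import Literature.Analysis.ODE.GlobalExistence
import Literature.Topology.Euclidean.BrouwerAcuteAngle
import HarnessLib

/-!
# Periodic solutions of dissipative ordinary differential equations (Brouwer on the period map)

Trunk: analysis / ODE. Theorem-only support file for the Galerkin step of Bradshaw–Tsai's
construction of time-periodic weak solutions of the Leray system (Bradshaw–Tsai, Ann. Henri
Poincaré 18 (2017) = arXiv:1510.07504 [BT1], **Lemma 2.6**, part 1: "the system of ODEs has a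
`T`-periodic solution"), whose printed proof is the classical period-map argument:

> "By multiplying the `j`-th equation by `b_{kj}` and summing, since certain cubic terms vanish, we
> obtain `½ d/ds ‖U_k‖² + ½‖U_k‖² + ‖∇U_k‖² ≤ −(U_k·∇W, U_k) − ⟨ℛ(W), U_k⟩` …
> `d/ds ‖U_k‖² + ½‖U_k‖² + ½‖∇U_k‖² ≤ C₂`. The Gronwall inequality implies … `T̃` is not a blow-up
> time … we can choose `ρ > 0` (independent of `k`) so that `‖U⁰‖ ≤ ρ ⇒ ‖U_k(T)‖ ≤ ρ`. Let
> `T : B_ρ^k → B_ρ^k` map `b_k(0) → b_k(T)`, where `B_ρ^k` is the closed ball of radius `ρ` in `ℝ^k`.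
> This map is continuous and thus has a fixed point by the Brouwer fixed-point theorem, implying
> there exists some `U⁰` … so that `b_k(0) = b_k(T)`."

Abstracted: a vector field `v : ℝ → E → E` on a finite-dimensional real inner product space that is
Lipschitz on balls (uniformly in `t`), continuous in `t`, and **dissipative**,
`⟪v(t,x), x⟫ ≤ C − δ‖x‖²` (`C ≥ 0`, `δ > 0`), leaves the ball `‖x‖² ≤ C/δ` forward invariant, so its
solutions are global and the period map `x ↦ α_x(T)` is a continuous (indeed Lipschitz, by
Gronwall) self-map of that ball; Brouwer's fixed point theorem (the tree's
`Literature.Topology.Euclidean.Brouwer.exists_fixedPoint_closedBall_of_radius`, `BrouwerAcuteAngle`)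
gives a solution with `α(T) = α(0)`, and when `v` is `T`-periodic in `t` its periodic extension is
a global `T`-periodic `C¹` solution.

## Contents (all proved, no definitions)

* `ODE.norm_sq_le_of_dissipative` — **forward invariance of the absorbing ball**: along a solution
  on `[a,b]`, `‖α(a)‖² ≤ C/δ ⇒ ‖α(t)‖² ≤ C/δ` (`e^{2δt}(‖α‖² − C/δ)` is non-increasing).
* `ODE.exists_solution_eq_endpoints_of_dissipative` — a solution on `[0,T]` with `α T = α 0` inside
  the absorbing ball (global existence from the tree's `ODE.exists_solution_of_apriori_bound`,
  Lipschitz dependence on the initial point from Mathlib's `dist_le_of_trajectories_ODE_of_mem`,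
  Brouwer).
* `ODE.hasDerivAt_comp_toIcoMod` — the periodic extension `t ↦ α(t mod T)` of such a solution is a
  global solution when `v` is `T`-periodic.
* `ODE.exists_periodic_solution_of_dissipative` — **periodic solutions of periodic dissipative
  systems**: `∃ α`, `α' = v(t,α)` on `ℝ`, `α(t + T) = α(t)`, `‖α(t)‖² ≤ C/δ`.

## Mathlib / tree search

Mathlib (this pin): local Picard–Lindelöf, Gronwall (`dist_le_of_trajectories_ODE_of_mem`),
`toIcoMod`; no Brouwer, no periodic-solution existence theorem (searched `periodic` in
`Mathlib/Analysis/ODE`: none). Tree: `ODE.exists_solution_of_apriori_bound` (`GlobalExistence`),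
`Brouwer.exists_fixedPoint_closedBall_of_radius` (`Topology/Euclidean/BrouwerAcuteAngle`, over
`BrouwerFixedPoint`); `lean search 'periodic solution|period map|Poincare map'`: no prior
rendering.

## References

* Z. Bradshaw, T.-P. Tsai, *Forward discretely self-similar solutions of the Navier–Stokes
  equations II*, Ann. Henri Poincaré 18 (2017) 1095–1119 = arXiv:1510.07504, Lemma 2.6 and its
  proof [BradshawTsai2017AHP].
* G. Teschl, *Ordinary Differential Equations and Dynamical Systems*, GSM 140 (AMS 2012), §2
  (Picard–Lindelöf, Gronwall, continuation) [Teschl2012].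
-/

noncomputable section

open Set Metric Filter Topology

open scoped NNReal RealInnerProductSpace

namespace Literature.Analysis.ODE

/-! ## The absorbing ball of a dissipative field -/

section Energy

variable {E : Type*} [NormedAddCommGroup E] [InnerProductSpace ℝ E]

/-- **Forward invariance of the absorbing ball.** If `⟪v(t,x), x⟫ ≤ C − δ‖x‖²` (`δ > 0`) and `α`
solves `α' = v(t,α)` on `[a,b]` with `‖α(a)‖² ≤ C/δ`, then `‖α(t)‖² ≤ C/δ` on `[a,b]`: the function
`e^{2δt}(‖α(t)‖² − C/δ)` has derivative `e^{2δt}(2δ(‖α‖² − C/δ) + 2⟪α, v⟫) ≤ 0` (the energy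
inequality "`d/ds‖U_k‖² + ½‖U_k‖² + ½‖∇U_k‖² ≤ C₂`" and "`‖U⁰‖ ≤ ρ ⇒ ‖U_k(T)‖ ≤ ρ`" of the proof of
[BT1] Lemma 2.6). [cite: BradshawTsai2017AHP, proof of Lemma 2.6] -/
theorem norm_sq_le_of_dissipative {v : ℝ → E → E} {C δ : ℝ} (hδ : 0 < δ)
    (hdiss : ∀ t x, ⟪v t x, x⟫ ≤ C - δ * ‖x‖ ^ 2) {a b : ℝ} {α : ℝ → E}
    (hα : ∀ t ∈ Icc a b, HasDerivWithinAt α (v t (α t)) (Icc a b) t)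
    (ha : ‖α a‖ ^ 2 ≤ C / δ) : ∀ t ∈ Icc a b, ‖α t‖ ^ 2 ≤ C / δ := by
  intro t ht
  set z : ℝ → ℝ := fun s => Real.exp (2 * δ * s) * (‖α s‖ ^ 2 - C / δ) with hz
  set z' : ℝ → ℝ := fun s => 2 * δ * Real.exp (2 * δ * s) * (‖α s‖ ^ 2 - C / δ) +
    Real.exp (2 * δ * s) * (2 * ⟪α s, v s (α s)⟫) with hz'
  have hzd : ∀ s ∈ Icc a b, HasDerivWithinAt z (z' s) (Icc a b) s := by
    intro s hs
    have h1 : HasDerivWithinAt (fun s => Real.exp (2 * δ * s)) (2 * δ * Real.exp (2 * δ * s))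
        (Icc a b) s := by
      have h := ((hasDerivAt_id s).const_mul (2 * δ)).exp
      exact (h.congr_deriv (by simp only [id_eq, mul_one]; ring)).hasDerivWithinAt
    have h2 : HasDerivWithinAt (fun s => ‖α s‖ ^ 2 - C / δ) (2 * ⟪α s, v s (α s)⟫) (Icc a b) s :=
      (hα s hs).norm_sq.sub_const _
    exact h1.mul h2
  have hz'le : ∀ s ∈ Icc a b, z' s ≤ 0 := by
    intro s _
    have hd := hdiss s (α s)
    rw [real_inner_comm] at hd
    have hCδ : δ * (C / δ) = C := mul_div_cancel₀ C hδ.ne'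
    have h3 : 2 * δ * (‖α s‖ ^ 2 - C / δ) + 2 * ⟪α s, v s (α s)⟫ ≤ 0 := by nlinarith [hd, hCδ]
    have h4 : z' s = Real.exp (2 * δ * s) * (2 * δ * (‖α s‖ ^ 2 - C / δ) + 2 * ⟪α s, v s (α s)⟫) := by
      rw [hz']; ring
    rw [h4]
    exact mul_nonpos_iff.2 (Or.inl ⟨(Real.exp_pos _).le, h3⟩)
  have hanti : AntitoneOn z (Icc a b) := by
    refine antitoneOn_of_hasDerivWithinAt_nonpos (f' := z') (convex_Icc a b)
      (fun s hs => (hzd s hs).continuousWithinAt) ?_ ?_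
    · intro s hs
      rw [interior_Icc] at hs ⊢
      exact (hzd s (Ioo_subset_Icc_self hs)).mono Ioo_subset_Icc_self
    · intro s hs
      rw [interior_Icc] at hs
      exact hz'le s (Ioo_subset_Icc_self hs)
  have hza : z a ≤ 0 :=
    mul_nonpos_iff.2 (Or.inl ⟨(Real.exp_pos _).le, sub_nonpos.2 ha⟩)
  have hzt : z t ≤ 0 := (hanti (left_mem_Icc.2 (ht.1.trans ht.2)) ht ht.1).trans hza
  by_contra hcon
  have hpos : 0 < z t := mul_pos (Real.exp_pos _) (sub_pos.2 (not_le.1 hcon))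
  exact absurd hzt (not_le.2 hpos)

end Energy

/-! ## The period map and its fixed point -/

section Periodic

variable {E : Type*} [NormedAddCommGroup E] [InnerProductSpace ℝ E] [FiniteDimensional ℝ E]

/-- **A solution with `α(T) = α(0)` for a dissipative field** (the period-map argument of the proof
of [BT1] Lemma 2.6: "Let `T : B_ρ^k → B_ρ^k` map `b_k(0) → b_k(T)` … This map is continuous and
thus has a fixed point by the Brouwer fixed-point theorem"). Let `v` be Lipschitz on every ball
uniformly in `t`, continuous in `t`, with `⟪v(t,x), x⟫ ≤ C − δ‖x‖²` (`C ≥ 0`, `δ > 0`), and `T > 0`.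
Then some solution of `α' = v(t,α)` on `[0,T]` satisfies `α T = α 0` and `‖α(t)‖² ≤ C/δ`. Proof:
solutions from the absorbing ball `‖x‖² ≤ C/δ` exist globally and stay in it
(`norm_sq_le_of_dissipative`, `exists_solution_of_apriori_bound`); the period map `x ↦ α_x(T)`
is Lipschitz on the ball by Gronwall (`dist_le_of_trajectories_ODE_of_mem`); Brouwer. [cite: BradshawTsai2017AHP, proof of Lemma 2.6] -/
theorem exists_solution_eq_endpoints_of_dissipative {v : ℝ → E → E} {T : ℝ} (hT : 0 < T)
    (hlip : ∀ ρ : ℝ, ∃ K : ℝ≥0, ∀ t, LipschitzOnWith K (v t) (closedBall 0 ρ))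
    (hcont : ∀ x, Continuous fun t => v t x) {C δ : ℝ} (hC : 0 ≤ C) (hδ : 0 < δ)
    (hdiss : ∀ t x, ⟪v t x, x⟫ ≤ C - δ * ‖x‖ ^ 2) :
    ∃ α : ℝ → E, (∀ t ∈ Icc 0 T, HasDerivWithinAt α (v t (α t)) (Icc 0 T) t) ∧ α T = α 0 ∧
      ∀ t ∈ Icc 0 T, ‖α t‖ ^ 2 ≤ C / δ := by
  haveI : CompleteSpace E := FiniteDimensional.complete ℝ E
  set R : ℝ := Real.sqrt (C / δ) with hR
  have hR0 : 0 ≤ R := Real.sqrt_nonneg _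
  have hCδ : 0 ≤ C / δ := div_nonneg hC hδ.le
  have hsqR : ∀ x : E, ‖x‖ ^ 2 ≤ C / δ ↔ ‖x‖ ≤ R := fun x => by
    rw [hR, ← Real.sqrt_le_sqrt_iff hCδ, Real.sqrt_sq (norm_nonneg _)]
  -- global solutions issued from the absorbing ball
  have hglob : ∀ x : E, ‖x‖ ≤ R → ∃ α : ℝ → E, α 0 = x ∧
      ∀ T', ∀ t ∈ Icc 0 T', HasDerivWithinAt α (v t (α t)) (Icc 0 T') t := by
    intro x hx
    refine exists_solution_of_apriori_bound (fun T' ρ => ?_) (fun y => (hcont y).continuousOn) ?_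
    · obtain ⟨K, hK⟩ := hlip ρ
      exact ⟨K, fun t _ => hK t⟩
    · intro T' _
      refine ⟨R, hx, fun s _ β hβ0 hβ t ht => ?_⟩
      have h0 : ‖β 0‖ ^ 2 ≤ C / δ := by rw [hβ0]; exact (hsqR x).2 hx
      exact (hsqR _).1 (norm_sq_le_of_dissipative hδ hdiss hβ h0 t ht)
  choose! sol hsol0 hsol using hglob
  have hsolT : ∀ x, ‖x‖ ≤ R → ∀ t ∈ Icc 0 T, HasDerivWithinAt (sol x) (v t (sol x t)) (Icc 0 T) t :=
    fun x hx => hsol x hx T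
  have hball : ∀ x, ‖x‖ ≤ R → ∀ t ∈ Icc 0 T, ‖sol x t‖ ≤ R := by
    intro x hx t ht
    refine (hsqR _).1 (norm_sq_le_of_dissipative hδ hdiss (hsolT x hx) ?_ t ht)
    rw [hsol0 x hx]
    exact (hsqR x).2 hx
  -- the period map
  set P : E → E := fun x => sol x T with hP
  have hPmaps : MapsTo P (closedBall (0 : E) R) (closedBall (0 : E) R) := by
    intro x hx
    rw [mem_closedBall_zero_iff] at hx ⊢
    exact hball x hx T (right_mem_Icc.2 hT.le)
  obtain ⟨K, hK⟩ := hlip R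
  have hcont' : ∀ z, ‖z‖ ≤ R → ContinuousOn (sol z) (Icc 0 T) := fun z hz t ht =>
    (hsolT z hz t ht).continuousWithinAt
  have hder' : ∀ z, ‖z‖ ≤ R → ∀ t ∈ Ico 0 T,
      HasDerivWithinAt (sol z) (v t (sol z t)) (Ici t) t := by
    intro z hz t ht
    refine (hsolT z hz t (Ico_subset_Icc_self ht)).mono_of_mem_nhdsWithin ?_
    exact mem_of_superset (Icc_mem_nhdsGE ht.2) (Icc_subset_Icc ht.1 le_rfl)
  have hPlip : ∀ x ∈ closedBall (0 : E) R, ∀ y ∈ closedBall (0 : E) R,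
      dist (P x) (P y) ≤ dist x y * Real.exp (K * (T - 0)) := by
    intro x hx y hy
    rw [mem_closedBall_zero_iff] at hx hy
    refine dist_le_of_trajectories_ODE_of_mem (v := v) (s := fun _ => closedBall (0 : E) R)
      (K := K) (fun t _ => hK t) (hcont' x hx) (hder' x hx)
      (fun t ht => mem_closedBall_zero_iff.2 (hball x hx t (Ico_subset_Icc_self ht)))
      (hcont' y hy) (hder' y hy)
      (fun t ht => mem_closedBall_zero_iff.2 (hball y hy t (Ico_subset_Icc_self ht)))
      (le_of_eq ?_) T (right_mem_Icc.2 hT.le)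
    rw [hsol0 x hx, hsol0 y hy]
  have hPcont : ContinuousOn P (closedBall (0 : E) R) := by
    refine (LipschitzOnWith.of_dist_le_mul
      (K := (Real.exp (K * (T - 0))).toNNReal) fun x hx y hy => ?_).continuousOn
    rw [Real.coe_toNNReal _ (Real.exp_pos _).le, mul_comm]
    exact hPlip x hx y hy
  obtain ⟨x, hx, hfix⟩ : ∃ x ∈ closedBall (0 : E) R, P x = x := by
    rcases hR0.eq_or_lt with h | h
    · refine ⟨0, mem_closedBall_self hR0, ?_⟩
      have h0 := hPmaps (mem_closedBall_self hR0)
      rw [mem_closedBall_zero_iff, ← h, norm_le_zero_iff] at h0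
      exact h0
    · exact Literature.Topology.Euclidean.Brouwer.exists_fixedPoint_closedBall_of_radius h hPcont
        hPmaps
  rw [mem_closedBall_zero_iff] at hx
  refine ⟨sol x, hsolT x hx, ?_, fun t ht => (hsqR _).2 (hball x hx t ht)⟩
  rw [hsol0 x hx]
  exact hfix

omit [FiniteDimensional ℝ E] in
/-- **The periodic extension of a solution with `α(T) = α(0)` is a global solution** when the
field is `T`-periodic in `t`: `β(t) = α(t mod T)` (Mathlib's `toIcoMod`) has
`β' = v(t, β)` at every `t` (inside a period window by translation; at the nodes `nT` the one-sided
derivatives `v(T, α(T))` and `v(0, α(0))` agree). [folklore] -/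
theorem hasDerivAt_comp_toIcoMod {v : ℝ → E → E} {T : ℝ} (hT : 0 < T)
    (hper : ∀ t x, v (t + T) x = v t x) {α : ℝ → E}
    (hα : ∀ t ∈ Icc 0 T, HasDerivWithinAt α (v t (α t)) (Icc 0 T) t) (hαT : α T = α 0) (t : ℝ) :
    HasDerivAt (fun s => α (toIcoMod hT 0 s)) (v t (α (toIcoMod hT 0 t))) t := by
  set β : ℝ → E := fun s => α (toIcoMod hT 0 s) with hβ
  have hvper : Function.Periodic v T := fun s => funext (hper s)
  set n : ℤ := toIcoDiv hT 0 t with hn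
  set t₀ : ℝ := n • T with ht₀
  have htt₀ : t - t₀ = toIcoMod hT 0 t := by rw [ht₀, hn, self_sub_toIcoDiv_zsmul]
  have hmem : t - t₀ ∈ Ico 0 T := by
    rw [htt₀]
    simpa using toIcoMod_mem_Ico hT 0 t
  -- `β` on the window `[t₀, t₀ + T]`
  have hright : ∀ s ∈ Icc t₀ (t₀ + T), β s = α (s - t₀) := by
    intro s hs
    simp only [hβ]
    rcases hs.2.eq_or_lt with h | h
    · rw [h, add_sub_cancel_left, hαT]
      congr 1
      rw [toIcoMod_eq_iff]
      refine ⟨by simp [hT], n + 1, ?_⟩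
      rw [ht₀, zero_add, add_zsmul, one_zsmul]
    · congr 1
      rw [toIcoMod_eq_iff]
      refine ⟨⟨by linarith [hs.1], by linarith⟩, n, ?_⟩
      rw [ht₀]
      ring
  -- `β` on the window `[t₀ - T, t₀]`
  have hleft : ∀ s ∈ Icc (t₀ - T) t₀, β s = α (s - t₀ + T) := by
    intro s hs
    simp only [hβ]
    rcases hs.2.eq_or_lt with h | h
    · rw [h, sub_self, zero_add, hαT]
      congr 1
      rw [toIcoMod_eq_iff]
      exact ⟨by simp [hT], n, by rw [ht₀, zero_add]⟩
    · congr 1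
      rw [toIcoMod_eq_iff]
      refine ⟨⟨by linarith [hs.1], by linarith⟩, n - 1, ?_⟩
      rw [ht₀, sub_zsmul, one_zsmul]
      ring
  -- periodicity of `v` over `n` periods
  have hvn : ∀ s x, v (s + t₀) x = v s x := by
    intro s x
    have h := (hvper.zsmul n) s
    rw [← ht₀] at h
    exact congrFun h x
  by_cases hint : 0 < t - t₀
  · -- interior point of the window
    have hint' : t - t₀ ∈ Ioo 0 T := ⟨hint, hmem.2⟩
    have h1 : HasDerivAt α (v (t - t₀) (α (t - t₀))) (t - t₀) :=
      (hα _ (Ioo_subset_Icc_self hint')).hasDerivAt (Icc_mem_nhds hint'.1 hint'.2)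
    have hd : HasDerivAt (fun s => α (s - t₀)) (v (t - t₀) (α (t - t₀))) t := by
      simpa using h1.comp_sub_const t t₀
    have heq : (fun s => α (s - t₀)) =ᶠ[𝓝 t] β := by
      have : Ioo t₀ (t₀ + T) ∈ 𝓝 t := Ioo_mem_nhds (by linarith) (by linarith [hmem.2])
      filter_upwards [this] with s hs
      exact (hright s (Ioo_subset_Icc_self hs)).symm
    have hd' := hd.congr_of_eventuallyEq heq.symm
    have hval : v t (α (toIcoMod hT 0 t)) = v (t - t₀) (α (t - t₀)) := by
      rw [← htt₀, ← hvn (t - t₀), sub_add_cancel]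
    rw [hval]
    exact hd'
  · -- a node `t = t₀`
    have ht0 : t = t₀ := by
      have : t - t₀ = 0 := le_antisymm (not_lt.1 hint) hmem.1
      linarith
    -- right derivative at `t₀`
    have hR : HasDerivWithinAt β (v 0 (α 0)) (Icc t₀ (t₀ + T)) t₀ := by
      have h1 : HasDerivWithinAt α (v 0 (α 0)) (Icc 0 T) ((fun s => s - t₀) t₀) := by
        simp only [sub_self]
        exact hα 0 (left_mem_Icc.2 hT.le)
      have hg : HasDerivWithinAt (fun s => s - t₀) 1 (Icc t₀ (t₀ + T)) t₀ :=
        ((hasDerivAt_id t₀).sub_const t₀).hasDerivWithinAt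
      have hmaps : MapsTo (fun s => s - t₀) (Icc t₀ (t₀ + T)) (Icc 0 T) := fun s hs =>
        ⟨by linarith [hs.1], by linarith [hs.2]⟩
      have h2 := h1.scomp t₀ (h := fun s => s - t₀) hg hmaps
      simp only [one_smul] at h2
      exact h2.congr (fun s hs => hright s hs) (hright t₀ ⟨le_rfl, by linarith⟩)
    -- left derivative at `t₀`
    have hL : HasDerivWithinAt β (v T (α T)) (Icc (t₀ - T) t₀) t₀ := by
      have h1 : HasDerivWithinAt α (v T (α T)) (Icc 0 T) ((fun s => s - t₀ + T) t₀) := by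
        simp only [sub_self, zero_add]
        exact hα T (right_mem_Icc.2 hT.le)
      have hg : HasDerivWithinAt (fun s => s - t₀ + T) 1 (Icc (t₀ - T) t₀) t₀ :=
        (((hasDerivAt_id t₀).sub_const t₀).add_const T).hasDerivWithinAt
      have hmaps : MapsTo (fun s => s - t₀ + T) (Icc (t₀ - T) t₀) (Icc 0 T) := fun s hs =>
        ⟨by linarith [hs.1], by linarith [hs.2]⟩
      have h2 := h1.scomp t₀ (h := fun s => s - t₀ + T) hg hmaps
      simp only [one_smul] at h2
      exact h2.congr (fun s hs => hleft s hs) (hleft t₀ ⟨by linarith, le_rfl⟩)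
    have hval1 : v T (α T) = v 0 (α 0) := by
      rw [hαT]
      have h := hper 0 (α 0)
      rwa [zero_add] at h
    have hval2 : v t (α (toIcoMod hT 0 t)) = v 0 (α 0) := by
      have hb : α (toIcoMod hT 0 t) = α 0 := by
        have h := hright t₀ ⟨le_rfl, by linarith⟩
        simp only [hβ, sub_self] at h
        rw [ht0]
        exact h
      rw [hb, ht0, ← hvn 0, zero_add]
    have hU : HasDerivWithinAt β (v 0 (α 0)) (Icc (t₀ - T) t₀ ∪ Icc t₀ (t₀ + T)) t₀ :=
      (hval1 ▸ hL).union hR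
    have hnhds : Icc (t₀ - T) t₀ ∪ Icc t₀ (t₀ + T) ∈ 𝓝 t₀ := by
      rw [Icc_union_Icc_eq_Icc (by linarith) (by linarith)]
      exact Icc_mem_nhds (by linarith) (by linarith)
    rw [hval2, ht0]
    exact hU.hasDerivAt hnhds

/-- **Periodic solutions of periodic dissipative systems** ([BT1] Lemma 2.6, part 1, abstracted:
"the system of ODEs has a `T`-periodic solution `b_k ∈ H¹(0,T)`", with the bound "independent of
`k`" of part 2 in the form `‖α(t)‖² ≤ C/δ`). Let `E` be a finite-dimensional real inner product
space, `T > 0`, and `v : ℝ → E → E` `T`-periodic in `t`, Lipschitz on every ball uniformly in `t`,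
continuous in `t`, and dissipative: `⟪v(t,x), x⟫ ≤ C − δ‖x‖²` with `C ≥ 0`, `δ > 0`. Then there is a
global solution `α` of `α' = v(t, α)` which is `T`-periodic and satisfies `‖α(t)‖² ≤ C/δ` for all
`t`. [cite: BradshawTsai2017AHP, Lemma 2.6 (proof: Gronwall, period map, Brouwer)] -/
theorem exists_periodic_solution_of_dissipative {v : ℝ → E → E} {T : ℝ} (hT : 0 < T)
    (hper : ∀ t x, v (t + T) x = v t x)
    (hlip : ∀ ρ : ℝ, ∃ K : ℝ≥0, ∀ t, LipschitzOnWith K (v t) (closedBall 0 ρ))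
    (hcont : ∀ x, Continuous fun t => v t x) {C δ : ℝ} (hC : 0 ≤ C) (hδ : 0 < δ)
    (hdiss : ∀ t x, ⟪v t x, x⟫ ≤ C - δ * ‖x‖ ^ 2) :
    ∃ α : ℝ → E, (∀ t, HasDerivAt α (v t (α t)) t) ∧ (∀ t, α (t + T) = α t) ∧
      ∀ t, ‖α t‖ ^ 2 ≤ C / δ := by
  obtain ⟨α, hα, hαT, hbd⟩ := exists_solution_eq_endpoints_of_dissipative hT hlip hcont hC hδ hdiss
  refine ⟨fun t => α (toIcoMod hT 0 t), hasDerivAt_comp_toIcoMod hT hper hα hαT,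
    fun t => by simp only [toIcoMod_add_right], fun t => hbd _ ?_⟩
  have h := toIcoMod_mem_Ico hT 0 t
  rw [zero_add] at h
  exact Ico_subset_Icc_self h

end Periodic

end Literature.Analysis.ODE

end
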